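import Summits.QuantumFields.YangMills.Theorems.DressedRitz.Negative.RawVacuumLoadBearingDressed
import Summits.QuantumFields.YangMills.Theorems.LuscherReductionDressedRitzPolyakovLiftShadowPositivity
import Summits.QuantumFields.YangMills.Theorems.LuscherReductionDressedRitzPolyakovLiftChannelUniversality
import HarnessLib

/-!
# Crux `DressedRitz` (stmt-QuantumFields-20205), line «polyakovlift» SKELETONS r4 (`11e28270fd13c0fc`) ∕ r5 (channel universality) —
# NEGATIVE lemmas on the two new levers S-PSCAL (`PScalingExistsAt`) and S-UNIV (`UniversalityAt` r4 ∕ `ChannelUniversalityAt` r5):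
# which hypotheses are load-bearing, and which clause bodies are blind to the degenerate (zero) vacua

Standing crux disprover `ym-cdisprove-20205-1` g2 (refuter), supporting item stmt-QuantumFields-20205 (NO verdict change: the crux and the four
registered stubs `stub_liftStatics` ∕ `stub_universality` ∕ `stub_pscaling` ∕ `stub_liftLeakage` stay OPEN).  Shadow-side twin of
`RawVacuumLoadBearing(Dressed).lean`:

* §1 zero lemmas for the one-site SHADOW: `shadowVec_zeroVac`, `shadowFamily_zeroVac` (the shadow of any basis over the zero one-site vacuum is the
  zero family), `powLink_zero`, `ins_const_of_normalised`, `shadowVec_lengthZero` (at lattice LENGTH `L = 0` every shadow insertion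
  `g ∘ powLink 0` is a constant, so the shadow family of a normalised vacuum is null);
* §1b `ins_smul_vacuum` — the vacuum subtraction `OpPlat.ins` is CUBIC in the vacuum slot:
  `ins (c•φ) O = c•ins φ O + (c(1−c²)⟨φ,Oφ⟩)•φ`; it is a correct (vacuum-orthogonal) subtraction only at `⟨φ,φ⟩ = 1` — the normalisation clause
  of `IsRawVacuum` therefore enters S-UNIV ∕ S-PSCAL through `ins` itself (vacuum contamination of the channel vectors), not only through (o0)∕(o0′);
* §2 ★ `pscalingExistsAt_false_without_normalisation` — the registered text of `PScalingExistsAt k` (`k ≥ 1`) with the one-site raw-vacuum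
  hypothesis `IsRawVacuum B e₀` weakened to `IsPhys e₀ ∧ K_B e₀ = μ₀ e₀` is FALSE (witness `e₀ = 0`: (o0′) reads `0 < 0` for every basis);
* §3 ★ `pscalingExistsAt_false_from_lengthZero` — the same text with the threshold `∃ L0, ∀ L ≥ L0` replaced by `∀ L` is FALSE (witness `L = 0`:
  `B = 0`, a genuine normalised one-site vacuum `e₀` of `K_0`, and `powLink 0 ≡ 1` kills every insertion) — the threshold `L0 ≥ 1` is used;
* §4 `channelUniversality_body_zeroFine` ∕ `channelUniversality_body_zeroShadow` — the r5 (A5)∧(A6′) clause body of `ChannelUniversalityAt` holds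
  with EVERY constant as soon as EITHER family is the zero family (each clause is homogeneous of positive degree in `u` and in `w` separately), and
  `channelUniversalityAt_body_at_zero_vacua` instantiates this at `φ = 0` (any `e₀`) and at `e₀ = 0` (any `φ`): S-UNIV r5 cannot see either
  normalisation through (o0)-type clauses — its non-degeneracy is imported from S-STAT (o0) and S-PSCAL (o0′) at composition time;
* §5 ★ `universalityAt_false_without_normalisation` — the r4 lever: the text of `UniversalityAt k` (`k ≥ 1`) with `IsRawVacuum β φ` weakened to
  `IsPhys φ ∧ K_βφ = λ₀φ` is FALSE: clause (An) `|n^f_i − n^o_i| ≤ Cλ n^o_i` at `φ = 0` reads `n^o_i ≤ Cλ n^o_i` with `n^o_i > 0`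
  (`shadowFamily_o0`) and `Cλ < 1` deep in the window.  (r4's `∀ k, UniversalityAt k` was withdrawn by the lead for r5 on scale grounds; this
  lemma records that its (An) clause was the ONLY place where S-UNIV saw the fine normalisation.)
* §0 degenerate instances: `channelUniversalityAt_zero`, `universalityAt_zero`, `pscalingExistsAt_zero` (`k = 0` carries no content).

HONEST FRAMING: hypothesis bookkeeping at fixed lattice on the CONDITIONAL femto rung R2b1 (RunningReduction ⇐ TwistedTraceScaling ∧ DressedRitz);
nothing here is an estimate on the fine transfer operator, nothing bears on infinite volume, the continuum limit or the Clay mass gap.  [folklore]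
-/

set_option autoImplicit false

noncomputable section

open MeasureTheory Filter Topology Real
open Literature.MathematicalPhysics.QuantumFieldTheory
open Literature.MathematicalPhysics.QuantumLattice

namespace Summit.QuantumFields.YangMills.Theorems.FemtoTransferGap.PolyakovLift.Negative

open Summit.QuantumFields.YangMills.Theorems.FemtoTransferGap
open Summit.QuantumFields.YangMills.Theorems.FemtoTransferGap.PolyakovLift

/-! ## §0 Degenerate instances: `k = 0` carries no content -/

/-- `ChannelUniversalityAt 0` holds trivially (all clauses range over `Fin 0`). [folklore] -/
theorem channelUniversalityAt_zero : ChannelUniversalityAt 0 := by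
  refine ⟨0, 1, le_rfl, one_pos, fun lam _ _ => ⟨0, fun L _ _ β _ φ _ ω g _ e₀ _ => ?_⟩⟩
  exact ⟨fun i => i.elim0, fun i => i.elim0⟩

/-- `UniversalityAt 0` holds trivially. [folklore] -/
theorem universalityAt_zero : UniversalityAt 0 := by
  refine ⟨0, 1, le_rfl, one_pos, fun lam _ _ => ⟨0, fun L _ _ β _ φ _ ω g _ e₀ _ => ?_⟩⟩
  exact ⟨fun i => i.elim0, fun i => i.elim0, fun i => i.elim0⟩

/-- `PScalingExistsAt 0` holds trivially (a lift basis exists at every `B₁ = 2/Λ³ > 0`). [folklore] -/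
theorem pscalingExistsAt_zero : PScalingExistsAt 0 := by
  refine ⟨0, 1, le_rfl, one_pos, fun lam hlam _ => ⟨0, fun L _ Λ hlo _ e₀ _ => ?_⟩⟩
  have hΛ : 0 < Λ := hlam.trans_le hlo
  have hB : 0 < 2 / Λ ^ 3 := by positivity
  obtain ⟨ω, g, hb⟩ := exists_liftBasis hB 0
  exact ⟨ω, g, hb, fun i => i.elim0, fun i => i.elim0, fun i => i.elim0⟩

/-! ## §1 Zero lemmas for the one-site shadow -/

/-- Over the zero one-site «vacuum» every shadow vector vanishes. [folklore] -/
theorem shadowVec_zeroVac (B : ℝ) (L : ℕ) (g : GaugeConfig 3 1 SU2 → ℝ) :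
    shadowVec B L (fun _ => (0 : ℝ)) g = fun _ => 0 := by
  unfold shadowVec
  rw [ins_zeroVac, iterate_transferApply_zeroVec]

/-- Over the zero one-site «vacuum» the shadow family is the zero family. [folklore] -/
theorem shadowFamily_zeroVac (B : ℝ) (L : ℕ) {k : ℕ} (g : Fin k → (GaugeConfig 3 1 SU2 → ℝ)) :
    shadowFamily B L (fun _ => (0 : ℝ)) g = fun _ _ => 0 := by
  funext i
  simp only [shadowFamily, shadowVec_zeroVac]

/-- `powLink 0 V ≡ 1`: at length zero the Polyakov power map is constant. [folklore] -/
theorem powLink_zero : powLink 0 = fun _ _ => 1 := by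
  funext V e
  simp [powLink]

/-- A CONSTANT insertion on a normalised vacuum is killed by the vacuum subtraction. [folklore] -/
theorem ins_const_of_normalised {L : ℕ} [NeZero L] {φ : GaugeConfig 3 L SU2 → ℝ} (hφ : l2 φ φ = 1) (c : ℝ) :
    OpPlat.ins φ (fun _ => c) = fun _ => 0 := by
  have hmul : ((fun _ => c) * φ : GaugeConfig 3 L SU2 → ℝ) = c • φ := by
    funext V
    simp [Pi.mul_apply, smul_eq_mul]
  have hc : l2 φ ((fun _ => c) * φ) = c := by
    rw [hmul, l2_smul_right'', hφ, mul_one]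
  funext U
  simp [OpPlat.ins, hc]

/-- ★ At lattice LENGTH `L = 0` the shadow of a normalised vacuum is null for EVERY basis function: `g ∘ powLink 0` is constant. [folklore] -/
theorem shadowVec_lengthZero (B : ℝ) {e₀ : GaugeConfig 3 1 SU2 → ℝ} (he : l2 e₀ e₀ = 1) (g : GaugeConfig 3 1 SU2 → ℝ) :
    shadowVec B 0 e₀ g = fun _ => 0 := by
  unfold shadowVec
  have hc : (g ∘ powLink 0) = fun _ => g (fun _ => 1) := by
    funext V
    simp [powLink_zero]
  rw [hc, ins_const_of_normalised he, iterate_transferApply_zeroVec]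

/-! ## §1b The vacuum subtraction is cubic in the vacuum slot -/

/-- `O · (c•φ) = c • (O·φ)`. [folklore] -/
theorem mul_smul_vec {L : ℕ} [NeZero L] (c : ℝ) (O φ : GaugeConfig 3 L SU2 → ℝ) : O * (c • φ) = c • (O * φ) := by
  funext V
  simp [Pi.mul_apply, Pi.smul_apply, smul_eq_mul, mul_left_comm]

/-- ★ **`OpPlat.ins` is cubic in the vacuum**: `ins (c•φ) O = c•ins φ O + (c(1−c²)⟨φ,Oφ⟩)•φ`.  For `c ∉ {0, ±1}` and `⟨φ,Oφ⟩ ≠ 0` the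
mis-normalised «vacuum» re-enters the channel vector; `ins` is vacuum-orthogonal only at `⟨φ,φ⟩ = 1` (tree: `PolyakovLift.sq_eq_one_and_eq` ∕
`PolyakovLift.ins_eq_smul` in `…PolyakovLiftRawVacuum.lean` transfer insertions between raw vacua using exactly `‖φ‖ = 1`).  Hence the clause `⟨φ,φ⟩ = 1` of `IsRawVacuum` is used by S-UNIV ∕ S-PSCAL through `ins`, not only through (o0)∕(o0′). [folklore] -/
theorem ins_smul_vacuum {L : ℕ} [NeZero L] (c : ℝ) (φ O : GaugeConfig 3 L SU2 → ℝ) :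
    OpPlat.ins (c • φ) O = c • OpPlat.ins φ O + (c * (1 - c ^ 2) * l2 φ (O * φ)) • φ := by
  have hq : l2 (c • φ) (O * (c • φ)) = c ^ 2 * l2 φ (O * φ) := by
    rw [mul_smul_vec, l2_smul_right'', l2_smul_left]
    ring
  funext U
  simp only [OpPlat.ins, hq, Pi.mul_apply, Pi.sub_apply, Pi.add_apply, Pi.smul_apply, smul_eq_mul]
  ring

/-- At `c = 0` and at `c = ±1` the correction term vanishes (consistency with `ins_zeroVac` and with the sign symmetry `φ ↦ −φ`). [folklore] -/
theorem ins_neg_vacuum {L : ℕ} [NeZero L] (φ O : GaugeConfig 3 L SU2 → ℝ) :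
    OpPlat.ins ((-1 : ℝ) • φ) O = (-1 : ℝ) • OpPlat.ins φ O := by
  rw [ins_smul_vacuum]
  norm_num

/-! ## §2 ★ S-PSCAL without the one-site normalisation is false -/

/-- ★★ **`PScalingExistsAt k` (`k ≥ 1`) WITHOUT THE NORMALISATION `⟨e₀,e₀⟩ = 1` is false — any proof of S-PSCAL must use it.**  The negated text is
the tree's `PScalingExistsAt k` VERBATIM except that `IsRawVacuum B e₀` (`B = 2L³/Λ³`) is weakened to `IsPhys e₀ ∧ K_B e₀ = μ₀(B) e₀`.  Witness:
`lam = Λ = lam0`, `L = L0`, the zero one-site vacuum (`isPhys_const 0`, `zeroVec_eigen`); whatever basis is returned, its shadow family is null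
(`shadowFamily_zeroVac`) and (o0′) reads `0 < 0`.  The `∀ k` shape of the registered `stub_pscaling : ∀ k, PScalingExistsAt k` so mutated is refuted at
`k = 1`. [folklore] -/
theorem pscalingExistsAt_false_without_normalisation {k : ℕ} (hk : 0 < k) :
    ¬ (∃ C lam0 : ℝ, 0 ≤ C ∧ 0 < lam0 ∧ ∀ lam : ℝ, 0 < lam → lam ≤ lam0 → ∃ L0 : ℕ, ∀ L : ℕ, L0 ≤ L →
        ∀ Λ : ℝ, lam ≤ Λ → Λ ≤ 2 * lam →
          ∀ e₀ : GaugeConfig 3 1 SU2 → ℝ, IsPhys e₀ →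
            transferApply (L := 1) (2 * (L : ℝ) ^ 3 / Λ ^ 3) e₀ = levelValue su2Rep 1 (2 * (L : ℝ) ^ 3 / Λ ^ 3) 0 • e₀ →
            ∃ (ω : GaugeConfig 3 1 SU2 → ℝ) (g : Fin k → (GaugeConfig 3 1 SU2 → ℝ)), LiftBasis (2 / Λ ^ 3) k ω g ∧
              let B : ℝ := 2 * (L : ℝ) ^ 3 / Λ ^ 3
              let w : Fin k → (GaugeConfig 3 1 SU2 → ℝ) := shadowFamily B L e₀ g
              let m0 := levelValue su2Rep 1 B 0
              (∀ i : Fin k, 0 < l2 (w i) (w i)) ∧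
              (∀ i : Fin k,
                l2 (w i) (transferApply B (w i)) * m0 ≤
                    Real.exp (C * Λ ^ 2 / L) * (levelValue su2Rep 1 B ((i : ℕ) + 1) * m0) * l2 (w i) (w i) ∧
                levelValue su2Rep 1 B ((i : ℕ) + 1) * m0 * l2 (w i) (w i) ≤
                    Real.exp (C * Λ ^ 2 / L) * (l2 (w i) (transferApply B (w i)) * m0)) ∧
              (∀ i l : Fin k, i ≠ l →
                |l2 (w i) (transferApply B (w l)) -
                    (l2 (w i) (transferApply B (w i)) / l2 (w i) (w i) + l2 (w l) (transferApply B (w l)) / l2 (w l) (w l)) / 2 *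
                      l2 (w i) (w l)|
                  ≤ C * (Λ ^ 2 / L) * m0 * (Real.sqrt (l2 (w i) (w i)) * Real.sqrt (l2 (w l) (w l))))) := by
  rintro ⟨C, lam0, -, hlam0, H⟩
  obtain ⟨L0, HL⟩ := H lam0 hlam0 le_rfl
  obtain ⟨ω, g, -, hpos, -⟩ :=
    HL L0 le_rfl lam0 le_rfl (by linarith) (fun _ => (0 : ℝ)) (isPhys_const 0) (zeroVec_eigen (L := 1) _)
  have h0 := hpos ⟨0, hk⟩
  rw [shadowFamily_zeroVac] at h0
  simp [l2_zeroVec_left] at h0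

/-! ## §3 ★ S-PSCAL without the length threshold is false: `L0 ≥ 1` is used -/

/-- ★★ **`PScalingExistsAt k` (`k ≥ 1`) WITHOUT THE THRESHOLD `L ≥ L0` is false.**  The negated text is the tree's `PScalingExistsAt k` VERBATIM except
that `∃ L0, ∀ L, L0 ≤ L → …` is replaced by `∀ L, …`.  Witness: `L = 0`, `lam = Λ = lam0`; then `B = 2·0³/Λ³ = 0`, a genuine normalised one-site
vacuum `e₀` of `K_0` exists (`PhysL2.exists_groundState`, `levelValue_zero`), and `powLink 0 ≡ 1` makes every shadow insertion constant, so the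
shadow family is null (`shadowVec_lengthZero`) and (o0′) reads `0 < 0`.  Any proof must take `L0 ≥ 1`. [folklore] -/
theorem pscalingExistsAt_false_from_lengthZero {k : ℕ} (hk : 0 < k) :
    ¬ (∃ C lam0 : ℝ, 0 ≤ C ∧ 0 < lam0 ∧ ∀ lam : ℝ, 0 < lam → lam ≤ lam0 → ∀ L : ℕ,
        ∀ Λ : ℝ, lam ≤ Λ → Λ ≤ 2 * lam →
          ∀ e₀ : GaugeConfig 3 1 SU2 → ℝ, IsRawVacuum (L := 1) (2 * (L : ℝ) ^ 3 / Λ ^ 3) e₀ →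
            ∃ (ω : GaugeConfig 3 1 SU2 → ℝ) (g : Fin k → (GaugeConfig 3 1 SU2 → ℝ)), LiftBasis (2 / Λ ^ 3) k ω g ∧
              let B : ℝ := 2 * (L : ℝ) ^ 3 / Λ ^ 3
              let w : Fin k → (GaugeConfig 3 1 SU2 → ℝ) := shadowFamily B L e₀ g
              let m0 := levelValue su2Rep 1 B 0
              (∀ i : Fin k, 0 < l2 (w i) (w i)) ∧
              (∀ i : Fin k,
                l2 (w i) (transferApply B (w i)) * m0 ≤
                    Real.exp (C * Λ ^ 2 / L) * (levelValue su2Rep 1 B ((i : ℕ) + 1) * m0) * l2 (w i) (w i) ∧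
                levelValue su2Rep 1 B ((i : ℕ) + 1) * m0 * l2 (w i) (w i) ≤
                    Real.exp (C * Λ ^ 2 / L) * (l2 (w i) (transferApply B (w i)) * m0)) ∧
              (∀ i l : Fin k, i ≠ l →
                |l2 (w i) (transferApply B (w l)) -
                    (l2 (w i) (transferApply B (w i)) / l2 (w i) (w i) + l2 (w l) (transferApply B (w l)) / l2 (w l) (w l)) / 2 *
                      l2 (w i) (w l)|
                  ≤ C * (Λ ^ 2 / L) * m0 * (Real.sqrt (l2 (w i) (w i)) * Real.sqrt (l2 (w l) (w l))))) := by
  rintro ⟨C, lam0, -, hlam0, H⟩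
  have HL := H lam0 hlam0 le_rfl 0 lam0 le_rfl (by linarith)
  have hB : (2 * ((0 : ℕ) : ℝ) ^ 3 / lam0 ^ 3 : ℝ) = 0 := by simp
  obtain ⟨Ω, θ, c, hΩ, -, -, hn, heig, -, -, -⟩ := PhysL2.exists_groundState (L := 1) (2 * ((0 : ℕ) : ℝ) ^ 3 / lam0 ^ 3)
  have hvac : IsRawVacuum (L := 1) (2 * ((0 : ℕ) : ℝ) ^ 3 / lam0 ^ 3) Ω := by
    refine ⟨hΩ, hn, ?_⟩
    rw [levelValue_zero]
    exact heig
  obtain ⟨ω, g, -, hpos, -⟩ := HL Ω hvac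
  have h0 := hpos ⟨0, hk⟩
  simp only [shadowFamily] at h0
  rw [shadowVec_lengthZero _ hn] at h0
  simp [l2_zeroVec_left] at h0

/-! ## §4 S-UNIV r5 (`ChannelUniversalityAt`) is blind to the zero vacua: every clause is homogeneous of positive degree in `u` and in `w` -/

section ChannelBody

variable {L : ℕ} [NeZero L] {k : ℕ}

/-- ★ The (A5) ∧ (A6′) clause body of `ChannelUniversalityAt` holds with EVERY constant `a`, every one-site family `w`, all `β, B, l0, m0`, as soon
as the FINE family is the zero family. [folklore] -/
theorem channelUniversality_body_zeroFine (a e β B l0 m0 : ℝ) (w : Fin k → (GaugeConfig 3 1 SU2 → ℝ)) :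
    let u : Fin k → (GaugeConfig 3 L SU2 → ℝ) := fun _ _ => 0
    (∀ i : Fin k,
      l2 (u i) (transferApply β (u i)) * l2 (w i) (w i) * m0 ≤ Real.exp e * (l2 (w i) (transferApply B (w i)) * l2 (u i) (u i) * l0) ∧
      l2 (w i) (transferApply B (w i)) * l2 (u i) (u i) * l0 ≤ Real.exp e * (l2 (u i) (transferApply β (u i)) * l2 (w i) (w i) * m0)) ∧
    (∀ i l : Fin k, i ≠ l →
      |(l2 (u i) (transferApply β (u l)) -
          (l2 (u i) (transferApply β (u i)) / l2 (u i) (u i) + l2 (u l) (transferApply β (u l)) / l2 (u l) (u l)) / 2 * l2 (u i) (u l)) *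
            m0 * (Real.sqrt (l2 (w i) (w i)) * Real.sqrt (l2 (w l) (w l))) -
        (l2 (w i) (transferApply B (w l)) -
          (l2 (w i) (transferApply B (w i)) / l2 (w i) (w i) + l2 (w l) (transferApply B (w l)) / l2 (w l) (w l)) / 2 * l2 (w i) (w l)) *
            l0 * (Real.sqrt (l2 (u i) (u i)) * Real.sqrt (l2 (u l) (u l)))|
        ≤ a * l0 * m0 * (Real.sqrt (l2 (u i) (u i)) * Real.sqrt (l2 (u l) (u l))) * (Real.sqrt (l2 (w i) (w i)) * Real.sqrt (l2 (w l) (w l)))) := by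
  refine ⟨fun i => ?_, fun i l _ => ?_⟩
  · simp [l2_zeroVec_left]
  · simp [l2_zeroVec_left]

/-- ★ … and likewise as soon as the ONE-SITE (shadow) family is the zero family, for every fine family `u`. [folklore] -/
theorem channelUniversality_body_zeroShadow (a e β B l0 m0 : ℝ) (u : Fin k → (GaugeConfig 3 L SU2 → ℝ)) :
    let w : Fin k → (GaugeConfig 3 1 SU2 → ℝ) := fun _ _ => 0
    (∀ i : Fin k,
      l2 (u i) (transferApply β (u i)) * l2 (w i) (w i) * m0 ≤ Real.exp e * (l2 (w i) (transferApply B (w i)) * l2 (u i) (u i) * l0) ∧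
      l2 (w i) (transferApply B (w i)) * l2 (u i) (u i) * l0 ≤ Real.exp e * (l2 (u i) (transferApply β (u i)) * l2 (w i) (w i) * m0)) ∧
    (∀ i l : Fin k, i ≠ l →
      |(l2 (u i) (transferApply β (u l)) -
          (l2 (u i) (transferApply β (u i)) / l2 (u i) (u i) + l2 (u l) (transferApply β (u l)) / l2 (u l) (u l)) / 2 * l2 (u i) (u l)) *
            m0 * (Real.sqrt (l2 (w i) (w i)) * Real.sqrt (l2 (w l) (w l))) -
        (l2 (w i) (transferApply B (w l)) -
          (l2 (w i) (transferApply B (w i)) / l2 (w i) (w i) + l2 (w l) (transferApply B (w l)) / l2 (w l) (w l)) / 2 * l2 (w i) (w l)) *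
            l0 * (Real.sqrt (l2 (u i) (u i)) * Real.sqrt (l2 (u l) (u l)))|
        ≤ a * l0 * m0 * (Real.sqrt (l2 (u i) (u i)) * Real.sqrt (l2 (u l) (u l))) * (Real.sqrt (l2 (w i) (w i)) * Real.sqrt (l2 (w l) (w l)))) := by
  refine ⟨fun i => ?_, fun i l _ => ?_⟩
  · simp [l2_zeroVec_left]
  · simp [l2_zeroVec_left]

end ChannelBody

/-- ★★ The registered r5 lever `ChannelUniversalityAt k` with BOTH raw-vacuum hypotheses deleted outright is NOT refuted by the zero vacua: its body
at `φ = 0` (any `e₀`; contrast S-STAT (o0), `not_staticClauses_dressedLiftFamily_zeroVac`) and at `e₀ = 0` (any `φ`; contrast S-PSCAL (o0′), §2)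
holds with every `C`.  (Whether it survives MIS-normalised vacua `c•Ω`,
`c ∉ {0,±1}`, is a different matter — see `ins_smul_vacuum`: the vacuum re-enters `u`, and after dressing the (A5) ratio of a contaminated channel
tends to `λ₀/λ₀ = 1`, not `λ_{i+1}/λ₀`; not decided here.) [folklore] -/
theorem channelUniversalityAt_body_at_zero_vacua (k : ℕ) (C : ℝ) {L : ℕ} [NeZero L] (β : ℝ)
    (g : Fin k → (GaugeConfig 3 1 SU2 → ℝ)) (φ : GaugeConfig 3 L SU2 → ℝ) (e₀ : GaugeConfig 3 1 SU2 → ℝ)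
    (hzero : φ = (fun _ => 0) ∨ e₀ = (fun _ => 0)) :
    let u := dressedLiftFamily β φ g
    let w := shadowFamily (oneSiteCoupling β L) L e₀ g
    let l0 := levelValue su2Rep L β 0
    let m0 := levelValue su2Rep 1 (oneSiteCoupling β L) 0
    (∀ i : Fin k,
      l2 (u i) (transferApply β (u i)) * l2 (w i) (w i) * m0 ≤
          Real.exp (C * luscherLambda β L ^ 2 / L) * (l2 (w i) (transferApply (oneSiteCoupling β L) (w i)) * l2 (u i) (u i) * l0) ∧
      l2 (w i) (transferApply (oneSiteCoupling β L) (w i)) * l2 (u i) (u i) * l0 ≤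
          Real.exp (C * luscherLambda β L ^ 2 / L) * (l2 (u i) (transferApply β (u i)) * l2 (w i) (w i) * m0)) ∧
    (∀ i l : Fin k, i ≠ l →
      |(l2 (u i) (transferApply β (u l)) -
          (l2 (u i) (transferApply β (u i)) / l2 (u i) (u i) + l2 (u l) (transferApply β (u l)) / l2 (u l) (u l)) / 2 *
            l2 (u i) (u l)) * m0 * (Real.sqrt (l2 (w i) (w i)) * Real.sqrt (l2 (w l) (w l))) -
        (l2 (w i) (transferApply (oneSiteCoupling β L) (w l)) -
          (l2 (w i) (transferApply (oneSiteCoupling β L) (w i)) / l2 (w i) (w i) +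
              l2 (w l) (transferApply (oneSiteCoupling β L) (w l)) / l2 (w l) (w l)) / 2 * l2 (w i) (w l)) * l0 *
          (Real.sqrt (l2 (u i) (u i)) * Real.sqrt (l2 (u l) (u l)))|
        ≤ C * (luscherLambda β L ^ 2 / L) * l0 * m0 *
          (Real.sqrt (l2 (u i) (u i)) * Real.sqrt (l2 (u l) (u l))) * (Real.sqrt (l2 (w i) (w i)) * Real.sqrt (l2 (w l) (w l)))) := by
  rcases hzero with h | h
  · subst h
    rw [dressedLiftFamily_zeroVac]
    exact channelUniversality_body_zeroFine (C * (luscherLambda β L ^ 2 / L)) (C * luscherLambda β L ^ 2 / L) β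
      (oneSiteCoupling β L) (levelValue su2Rep L β 0) (levelValue su2Rep 1 (oneSiteCoupling β L) 0)
      (shadowFamily (oneSiteCoupling β L) L e₀ g)
  · subst h
    rw [shadowFamily_zeroVac]
    exact channelUniversality_body_zeroShadow (C * (luscherLambda β L ^ 2 / L)) (C * luscherLambda β L ^ 2 / L) β
      (oneSiteCoupling β L) (levelValue su2Rep L β 0) (levelValue su2Rep 1 (oneSiteCoupling β L) 0) (dressedLiftFamily β φ g)

/-! ## §5 ★ The r4 lever: `UniversalityAt` without the fine normalisation is false ((An) sees `⟨φ,φ⟩ = 1`) -/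

/-- ★★ **`UniversalityAt k` (`k ≥ 1`, skeleton r4 `11e28270fd13c0fc`) WITHOUT THE FINE NORMALISATION is false.**  The negated text is the tree's
`UniversalityAt k` VERBATIM except that `IsRawVacuum β φ` is weakened to `IsPhys φ ∧ K_βφ = λ₀φ`.  Witness: `lam = min lam0 (min 1 (1/(2(C+1))))`,
`L = L0 + 1`, a window `β` with `λ(β,L) = lam` (`TwistedTraceScaling.Negative.exists_inFemtoWindow`), the zero fine vacuum, any lift basis at
`B₁ = 2/λ³` (`exists_liftBasis`), the genuine one-site vacuum `e₀` at `B = 2L³/λ³` (`PhysL2.exists_groundState`): the shadow norms are positive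
(`shadowFamily_o0`) while the fine ones vanish, so (An) at `i = 0` reads `n ≤ Cλ·n` with `Cλ ≤ C/(2(C+1)) < 1`.  The `∀ k` shape of the
registered r4 `stub_universality : ∀ k, UniversalityAt k` so mutated is refuted at `k = 1`. [folklore] -/
theorem universalityAt_false_without_normalisation {k : ℕ} (hk : 0 < k) :
    ¬ (∃ C lam0 : ℝ, 0 ≤ C ∧ 0 < lam0 ∧ ∀ lam : ℝ, 0 < lam → lam ≤ lam0 → ∃ L0 : ℕ,
        ∀ (L : ℕ) [NeZero L], L0 ≤ L → ∀ β : ℝ, InFemtoWindow lam β L →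
          ∀ φ : GaugeConfig 3 L SU2 → ℝ, IsPhys φ → transferApply β φ = levelValue su2Rep L β 0 • φ →
            ∀ (ω : GaugeConfig 3 1 SU2 → ℝ) (g : Fin k → (GaugeConfig 3 1 SU2 → ℝ)), LiftBasis (liftCoupling β L) k ω g →
              ∀ e₀ : GaugeConfig 3 1 SU2 → ℝ, IsRawVacuum (L := 1) (oneSiteCoupling β L) e₀ →
                let u := dressedLiftFamily β φ g
                let w := shadowFamily (oneSiteCoupling β L) L e₀ g
                let l0 := levelValue su2Rep L β 0
                let m0 := levelValue su2Rep 1 (oneSiteCoupling β L) 0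
                (∀ i : Fin k, |l2 (u i) (u i) - l2 (w i) (w i)| ≤ C * luscherLambda β L * l2 (w i) (w i)) ∧
                (∀ i : Fin k,
                  l2 (u i) (transferApply β (u i)) * l2 (w i) (w i) * m0 ≤
                      Real.exp (C * luscherLambda β L ^ 2 / L) * (l2 (w i) (transferApply (oneSiteCoupling β L) (w i)) * l2 (u i) (u i) * l0) ∧
                  l2 (w i) (transferApply (oneSiteCoupling β L) (w i)) * l2 (u i) (u i) * l0 ≤
                      Real.exp (C * luscherLambda β L ^ 2 / L) * (l2 (u i) (transferApply β (u i)) * l2 (w i) (w i) * m0)) ∧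
                (∀ i l : Fin k, i ≠ l →
                  |(l2 (u i) (transferApply β (u l)) -
                      (l2 (u i) (transferApply β (u i)) / l2 (u i) (u i) + l2 (u l) (transferApply β (u l)) / l2 (u l) (u l)) / 2 *
                        l2 (u i) (u l)) * m0 -
                    (l2 (w i) (transferApply (oneSiteCoupling β L) (w l)) -
                      (l2 (w i) (transferApply (oneSiteCoupling β L) (w i)) / l2 (w i) (w i) +
                          l2 (w l) (transferApply (oneSiteCoupling β L) (w l)) / l2 (w l) (w l)) / 2 * l2 (w i) (w l)) * l0|
                    ≤ C * (luscherLambda β L ^ 2 / L) * l0 * m0 * (Real.sqrt (l2 (w i) (w i)) * Real.sqrt (l2 (w l) (w l))))) := by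
  rintro ⟨C, lam0, hC, hlam0, H⟩
  -- the running parameter: small enough that `C·lam < 1`, inside `(0, 1]`
  set lam : ℝ := min lam0 (min 1 (1 / (2 * (C + 1)))) with hlam_def
  have hC1 : 0 < 2 * (C + 1) := by linarith
  have hlam : 0 < lam := lt_min hlam0 (lt_min one_pos (by positivity))
  have hlam1 : lam ≤ 1 := (min_le_right _ _).trans (min_le_left _ _)
  have hlamC : lam ≤ 1 / (2 * (C + 1)) := (min_le_right _ _).trans (min_le_right _ _)
  obtain ⟨L0, HL⟩ := H lam hlam (min_le_left _ _)
  obtain ⟨β, hW, hval⟩ :=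
    Summit.QuantumFields.YangMills.Theorems.TwistedTraceScaling.Negative.exists_inFemtoWindow (L0 + 1) hlam hlam1
  have hB' : 0 < liftCoupling β (L0 + 1) := by
    unfold liftCoupling
    rw [hval]
    positivity
  have hB : 0 < oneSiteCoupling β (L0 + 1) := by
    unfold oneSiteCoupling
    rw [hval]
    positivity
  obtain ⟨ω, g, hbasis⟩ := exists_liftBasis hB' k
  obtain ⟨e₀, θ, c, he₀, -, -, hn, heig, -, -, -⟩ := PhysL2.exists_groundState (L := 1) (oneSiteCoupling β (L0 + 1))
  have hvac : IsRawVacuum (L := 1) (oneSiteCoupling β (L0 + 1)) e₀ := by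
    refine ⟨he₀, hn, ?_⟩
    rw [levelValue_zero]
    exact heig
  obtain ⟨hAn, -, -⟩ :=
    HL (L0 + 1) (Nat.le_succ _) β hW (fun _ => (0 : ℝ)) (isPhys_const 0) (zeroVec_eigen β) ω g hbasis e₀ hvac
  have hpos := shadowFamily_o0 hB hB' (Nat.succ_pos L0) hvac hbasis ⟨0, hk⟩
  have h0 := hAn ⟨0, hk⟩
  rw [dressedLiftFamily_zeroVac, hval] at h0
  simp only [l2_zeroVec_left, zero_sub, abs_neg] at h0
  set n : ℝ := l2 (shadowFamily (oneSiteCoupling β (L0 + 1)) (L0 + 1) e₀ g ⟨0, hk⟩)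
    (shadowFamily (oneSiteCoupling β (L0 + 1)) (L0 + 1) e₀ g ⟨0, hk⟩) with hn_def
  rw [abs_of_pos hpos] at h0
  -- `n ≤ C·lam·n`, `n > 0` ⇒ `1 ≤ C·lam ≤ C/(2(C+1)) < 1`
  have h1 : 1 ≤ C * lam := by
    by_contra hlt
    have hlt' : C * lam < 1 := not_le.mp hlt
    have : C * lam * n < 1 * n := mul_lt_mul_of_pos_right hlt' hpos
    linarith
  have h2 : C * lam ≤ C * (1 / (2 * (C + 1))) := mul_le_mul_of_nonneg_left hlamC hC
  have h3 : C * (1 / (2 * (C + 1))) < 1 := by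
    rw [mul_one_div, div_lt_one hC1]
    linarith
  linarith

/-- Pointer: the registered texts imply the mutated ones on normalised vacua — the mutations of §2 and §5 delete exactly the clause `⟨·,·⟩ = 1`
(`isRawVacuum_iff`), the mutation of §3 deletes exactly the threshold.  Conversely the tree proves (o0′) FROM `IsRawVacuum` and `0 < L`
(`PolyakovLift.shadowFamily_o0`) — so for (o0′) the two deleted hypotheses are both necessary (this file) and sufficient (tree). [folklore] -/
theorem shadowFamily_o0_iff_of_zeroVac {k : ℕ} (hk : 0 < k) (B : ℝ) (L : ℕ) (g : Fin k → (GaugeConfig 3 1 SU2 → ℝ)) :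
    (∀ i : Fin k, 0 < l2 (shadowFamily B L (fun _ => (0 : ℝ)) g i) (shadowFamily B L (fun _ => (0 : ℝ)) g i)) ↔ False := by
  refine ⟨fun h => ?_, False.elim⟩
  have h0 := h ⟨0, hk⟩
  rw [shadowFamily_zeroVac] at h0
  simp [l2_zeroVec_left] at h0

end Summit.QuantumFields.YangMills.Theorems.FemtoTransferGap.PolyakovLift.Negative

end
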